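import Summits.HodgeConjecture.HodgeConjecture.Theorems.F0P3cStCharTSStTwist           -- ★ ST-TWIST (F0P3a-p06): `detZ_eq_iota_det_proj`, `areIsomorphicRep_smoothIndRep_congr`; brings ST-JH milieu, CLASS-TWIST KIT
import HarnessLib

/-!
# «PS-TWIST»: twisting a constituent of `i_G(χ₁, χ₂)` by `μ ∘ detZ` gives a constituent of `i_G(χ₁, χ₂·(μ∘ι))`
# (E1 ROW 35 «EP-CROSS (i) @ DATUM», input (C1); Rogawski 1990 §12.1–12.2, Bernstein–Zelevinsky 1977 1.9, Bushnell–Henniart 2006 §9.5)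

Cell `pub/hodgecm-mathlib`, crux H413 = `stmt-HodgeConjecture-24833`, LH6 leaf, organ (S-𝔑) `stub_EllipticInputs`, consequent 3 (`h61bRest`); E1 row 35 (keeper
F0P3a-p03 (g29); seat LH6-p03 (g9)).  THEOREMS ONLY (`--supports`, `--as helper`); no `def`, no instance, no notation, no `sorry`.  The general-pair twin of ★
ST-TWIST `inducingLine_twist_eq` ∕ `isConstituentOf_twist_stG` (there `χ₂ = ψ∘ι`; here ANY `χ₂`), in the same letters: the ST-PIN clauses `hι`, `hdetZ` as
hypotheses (`ι : E¹_v →* Z(G)` with matrix `z·1`, `detZ : G →* Z(G)` with matrix `det g · 1`).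

* `inducingLine_twist_pair_eq` — `(χ∘proj ⊗ δ^{1∕2}) ⊗ (μ∘detZ)|_B = (χ′∘proj ⊗ δ^{1∕2})` with `χ = (χ₁, χ₂)`, `χ′ = (χ₁, χ₂·(μ∘ι))` (`detZ p = ι(det proj p)` ★,
  `torusCharPair χ₁ χ₂ t = χ₁(t₀₀)·χ₂(det t)` — the twist touches ONLY the second coordinate).
* `isConstituentOf_twist_pair` — `c ∈ JH(i_G(χ₁, χ₂)) ⇒ c ⊗ (μ∘detZ) ∈ JH(i_G(χ₁, χ₂·(μ∘ι)))` (★ `IsConstituentOf.twist` + ★ `areIsomorphicRep_twist_smoothIndRep`).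
* `isConstituentOf_twist_xi` — the case-(2) reading: `JH(i_G(χ_ξ(μv, η₁, η₂))) ⊗ (μ∘detZ) ⊆ JH(i_G(χ_ξ(μv, η₁, η₂·(μ∘ι))))` (★ `cmXiTorusChar_eq_cmTorusCharPair`).

HONEST LABEL: count-neutral helper (row 35 input); h413 OPEN; HC_CM is proved only modulo the 7 printed citations (2 remaining: hLiu418 =
stmt-HodgeConjecture-24832, h413 = stmt-HodgeConjecture-24833) until rung 0 closes.
## References
* [Rogawski1990] J. D. Rogawski, *Automorphic Representations of Unitary Groups in Three Variables*, Ann. of Math. Stud. 123 (1990), §12.1 p. 171; §12.2 pp. 173–174.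
* [BernsteinZelevinsky1977] I. N. Bernstein, A. V. Zelevinsky, *Induced representations of reductive p-adic groups. I*, Ann. Sci. ÉNS 10 (1977), 1.9, §2.3.
* [BushnellHenniart2006] C. J. Bushnell, G. Henniart, *The Local Langlands Conjecture for GL(2)* (2006), §9.5 (9.5.1) p. 65.
-/

set_option autoImplicit false
-- the mandated namespace has the single-problem summit's repeated segment (`HodgeConjecture.HodgeConjecture`)
set_option linter.dupNamespace false

noncomputable section

open NumberField IsDedekindDomain MeasureTheory
open scoped Matrix MatrixGroups NNReal
open Literature.NumberTheory.Automorphic Literature.NumberTheory.Automorphic.UnitaryGroup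
open Literature.NumberTheory.Rogawski1990

namespace Summit.HodgeConjecture.HodgeConjecture.Cruxes.H413.F0P3cStCharTSPSTwist

open Summit.HodgeConjecture.HodgeConjecture.Cruxes.H413
open Summit.HodgeConjecture.HodgeConjecture.Cruxes.H413.F0P3cStCharTSStTwist

variable (L : Type) [Field L] [NumberField L] [IsCMField L] (v : HeightOneSpectrum (𝓞 ↥(maximalRealSubfield L)))

set_option maxHeartbeats 1600000 in
-- instance-path unification between `Gqs L v` and the literal carrier (the `detZ` rewrite on a Borel element), as in ★ ST-TWIST
/-- **The inducing line of `(χ₁, χ₂)`, twisted by `(μ∘detZ)|_B`, IS the inducing line of `(χ₁, χ₂·(μ∘ι))`** (equality of representations of `B` on `ℂ`):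
`μ(detZ p)·δ^{1/2}(p)·χ₁(α)·χ₂(det t) = δ^{1/2}(p)·χ₁(α)·(χ₂·μ∘ι)(det t)`, `t = proj p` (★ `detZ_eq_iota_det_proj`).  The general-pair form of ★ `inducingLine_twist_eq`.
[cite: Rogawski1990, §12.1 p. 171; §12.2 p. 173] [cite: BernsteinZelevinsky1977, 1.9] -/
theorem inducingLine_twist_pair_eq
    (ι : ↥(normOneUnits (conjLocal L (IsCMField.complexConj L) v)) →* ↥(Subgroup.center (Gqs L v)))
    (hι : ∀ z : ↥(normOneUnits (conjLocal L (IsCMField.complexConj L) v)),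
      ((ι z).val.val.val : Matrix (Fin 3) (Fin 3) (LocalRing L v)) = (((z : (LocalRing L v)ˣ) : LocalRing L v)) • (1 : Matrix (Fin 3) (Fin 3) (LocalRing L v)))
    (detZ : Gqs L v →* ↥(Subgroup.center (Gqs L v)))
    (hdetZ : ∀ g : Gqs L v, ((detZ g).val.val.val : Matrix (Fin 3) (Fin 3) (LocalRing L v)) =
        (g.val.val : Matrix (Fin 3) (Fin 3) (LocalRing L v)).det • (1 : Matrix (Fin 3) (Fin 3) (LocalRing L v)))
    (χ₁ : (LocalRing L v)ˣ →* ℂˣ) (χ₂ : ↥(normOneUnits (conjLocal L (IsCMField.complexConj L) v)) →* ℂˣ)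
    (μ : ↥(Subgroup.center (Gqs L v)) →* ℂˣ) :
    haveI := locallyCompactSpace_cmBorelU L 3 v
    (Representation.twist
        (((Representation.trivial ℂ ↥(torusU (conjLocal L (IsCMField.complexConj L) v) (cmLocalForm L 3 v)) ℂ).twist
          (cmTorusCharPair L v χ₁ χ₂)).comp (cmBorelTriple L 3 v).proj) (rootDeltaChar (cmBorelTriple L 3 v).P)).twist
        ((μ.comp detZ).comp (cmBorelTriple L 3 v).P.subtype) =
      Representation.twist
        (((Representation.trivial ℂ ↥(torusU (conjLocal L (IsCMField.complexConj L) v) (cmLocalForm L 3 v)) ℂ).twist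
          (cmTorusCharPair L v χ₁ (χ₂ * μ.comp ι))).comp (cmBorelTriple L 3 v).proj) (rootDeltaChar (cmBorelTriple L 3 v).P) := by
  haveI := locallyCompactSpace_cmBorelU L 3 v
  ext p
  have hθp : ((μ.comp detZ).comp (cmBorelTriple L 3 v).P.subtype) p =
      μ (ι (torusDetNormOne (conjLocal L (IsCMField.complexConj L) v) (cmLocalForm L 3 v) (cmLocalForm_eq_over L 3 v) ((cmBorelTriple L 3 v).proj p))) := by
    exact congrArg μ (detZ_eq_iota_det_proj L v ι hι detZ hdetZ p)
  rw [Representation.twist_apply, hθp]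
  simp only [Representation.twist_apply, MonoidHom.comp_apply, Representation.trivial_apply, cmTorusCharPair, torusCharPair_apply,
    MonoidHom.mul_apply, Units.val_mul, smul_eq_mul]
  ring

set_option maxHeartbeats 1600000 in
set_option synthInstance.maxHeartbeats 400000 in
-- instance-path unification between `Gqs L v` and the literal carrier of ★ `cmPrincipalSeries`, as in ★ ST-TWIST
/-- **«PS-TWIST»: `c ∈ JH(i_G(χ₁, χ₂)) ⇒ c ⊗ (μ∘detZ) ∈ JH(i_G(χ₁, χ₂·(μ∘ι)))`** for any continuous pair and any `μ : Z(G) →* ℂˣ` with open kernel of `μ∘detZ`: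
twisting preserves constituents (★ `IsConstituentOf.twist`), `i_G(χ) ⊗ μ∘detZ ≅ Ind_B((χ∘proj ⊗ δ^{1∕2}) ⊗ (μ∘detZ)|_B)` (★ `areIsomorphicRep_twist_smoothIndRep`) and the line
identity `inducingLine_twist_pair_eq`.  The general-pair form of ★ `isConstituentOf_twist_stG`. [cite: Rogawski1990, §12.2 pp. 173–174] [cite: BushnellHenniart2006, §9.5 (9.5.1) p. 65]
[cite: BernsteinZelevinsky1977, 1.9] -/
theorem isConstituentOf_twist_pair
    (ι : ↥(normOneUnits (conjLocal L (IsCMField.complexConj L) v)) →* ↥(Subgroup.center (Gqs L v)))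
    (hι : ∀ z : ↥(normOneUnits (conjLocal L (IsCMField.complexConj L) v)),
      ((ι z).val.val.val : Matrix (Fin 3) (Fin 3) (LocalRing L v)) = (((z : (LocalRing L v)ˣ) : LocalRing L v)) • (1 : Matrix (Fin 3) (Fin 3) (LocalRing L v)))
    (detZ : Gqs L v →* ↥(Subgroup.center (Gqs L v)))
    (hdetZ : ∀ g : Gqs L v, ((detZ g).val.val.val : Matrix (Fin 3) (Fin 3) (LocalRing L v)) =
        (g.val.val : Matrix (Fin 3) (Fin 3) (LocalRing L v)).det • (1 : Matrix (Fin 3) (Fin 3) (LocalRing L v)))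
    (χ₁ : (LocalRing L v)ˣ →* ℂˣ) (χ₂ : ↥(normOneUnits (conjLocal L (IsCMField.complexConj L) v)) →* ℂˣ)
    (μ : ↥(Subgroup.center (Gqs L v)) →* ℂˣ) (hopenμ : IsOpen (((μ.comp detZ).ker : Subgroup (Gqs L v)) : Set (Gqs L v)))
    {c : IrrClass (Gqs L v)} (hc : c.IsConstituentOf (cmPrincipalSeries L 3 v (cmTorusCharPair L v χ₁ χ₂))) :
    (c.twist (μ.comp detZ) hopenμ).IsConstituentOf (cmPrincipalSeries L 3 v (cmTorusCharPair L v χ₁ (χ₂ * μ.comp ι))) := by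
  haveI := locallyCompactSpace_cmBorelU L 3 v
  have hct := hc.twist (μ.comp detZ) hopenμ
  have hiso := areIsomorphicRep_twist_smoothIndRep (cmBorelTriple L 3 v).P
    (Representation.twist
      (((Representation.trivial ℂ ↥(torusU (conjLocal L (IsCMField.complexConj L) v) (cmLocalForm L 3 v)) ℂ).twist
        (cmTorusCharPair L v χ₁ χ₂)).comp (cmBorelTriple L 3 v).proj)
      (rootDeltaChar (cmBorelTriple L 3 v).P))
    (μ.comp detZ) hopenμ
  obtain ⟨f, hf⟩ := areIsomorphicRep_smoothIndRep_congr (inducingLine_twist_pair_eq L v ι hι detZ hdetZ χ₁ χ₂ μ) hiso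
  refine hct.of_injective ⟨f.toLinearMap, fun g => LinearMap.ext fun w => ?_⟩ (fun a b hab => f.injective (by exact hab))
  exact hf g w

set_option maxHeartbeats 1600000 in
set_option synthInstance.maxHeartbeats 400000 in
-- instance-path unification between `Gqs L v` and the literal carrier of ★ `cmPrincipalSeries`
/-- **The case-(2) reading**: `JH(i_G(χ_ξ(μv, η₁, η₂))) ⊗ (μ∘detZ) ⊆ JH(i_G(χ_ξ(μv, η₁, η₂·(μ∘ι))))` — twisting by a character of `Z(G)` through `detZ` moves the
case-(2) datum `ξ = (η₁, η₂)` to `(η₁, η₂·(μ∘ι))` and keeps `μv` (★ `cmXiTorusChar_eq_cmTorusCharPair`: `χ_ξ = (η̃₁·μv·‖·‖^{1∕2}, η₂)`).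
[cite: Rogawski1990, §12.2 (2) p. 174] [cite: BushnellHenniart2006, §9.5 (9.5.1) p. 65] -/
theorem isConstituentOf_twist_xi
    (ι : ↥(normOneUnits (conjLocal L (IsCMField.complexConj L) v)) →* ↥(Subgroup.center (Gqs L v)))
    (hι : ∀ z : ↥(normOneUnits (conjLocal L (IsCMField.complexConj L) v)),
      ((ι z).val.val.val : Matrix (Fin 3) (Fin 3) (LocalRing L v)) = (((z : (LocalRing L v)ˣ) : LocalRing L v)) • (1 : Matrix (Fin 3) (Fin 3) (LocalRing L v)))
    (detZ : Gqs L v →* ↥(Subgroup.center (Gqs L v)))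
    (hdetZ : ∀ g : Gqs L v, ((detZ g).val.val.val : Matrix (Fin 3) (Fin 3) (LocalRing L v)) =
        (g.val.val : Matrix (Fin 3) (Fin 3) (LocalRing L v)).det • (1 : Matrix (Fin 3) (Fin 3) (LocalRing L v)))
    (μv : (LocalRing L v)ˣ →* ℂˣ) (η₁ η₂ : ↥(normOneUnits (conjLocal L (IsCMField.complexConj L) v)) →* ℂˣ)
    (μ : ↥(Subgroup.center (Gqs L v)) →* ℂˣ) (hopenμ : IsOpen (((μ.comp detZ).ker : Subgroup (Gqs L v)) : Set (Gqs L v)))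
    {c : IrrClass (Gqs L v)} (hc : c.IsConstituentOf (cmPrincipalSeries L 3 v (cmXiTorusChar L v μv η₁ η₂))) :
    (c.twist (μ.comp detZ) hopenμ).IsConstituentOf (cmPrincipalSeries L 3 v (cmXiTorusChar L v μv η₁ (η₂ * μ.comp ι))) := by
  exact isConstituentOf_twist_pair L v ι hι detZ hdetZ _ η₂ μ hopenμ hc

end Summit.HodgeConjecture.HodgeConjecture.Cruxes.H413.F0P3cStCharTSPSTwist

end
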